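import Summits.QuantumFields.YangMills.Theorems.BalabanLadderROTSingleAngle
import Summits.QuantumFields.YangMills.Theorems.BalabanLadderROTClassDefs
import HarnessLib

/-!
# Crux `ROT` (stmt-QuantumFields-20042): the King side ON A TORUS CLASS — upgrade, one angle, and the closer of the candidate v5′ stub

Helper file (`--supports stmt-QuantumFields-20042 --as helper`) of the fleet lead `ym-spine-20042-p1` (generation g2).  Companion of
`Theorems/BalabanLadderROTClassDefs.lean` (§1 `UnboundedClass`, `LatticeRotWardOn`; §3 `LatticeKingWardOn`, `KingOnClass`) and of the PROVED
bridge re-run `Theorems/BalabanLadderROTBridgeOnClass.lean` (`bridgeOnClass`), for the owner's `ROT` rev 2′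
(`… → LowerBounds → MomentBounds6 → GapInUnits → ∃ S, UnboundedClass S ∧ LatticeRotWardOn G r a S`, ruling 2026-08-26T17:18:42Z).

The King-side lemmas of `Theorems/BalabanLadderROTOfKing.lean` / `…SingleAngle.lean` (seat g0; p4's `kingUpgrade`) re-run VERBATIM with
the torus class threaded — the upgrade is scheme-by-scheme, so restricting the schemes to a class costs nothing:

* `latticeRotWardOn_of_uvCompactAt_of_latticeKingWardOn` — UV compactness + KING at a densely-generating angle set ON THE CLASS ⇒ the
  rotation-Ward leg ON THE CLASS;
* `latticeKingWardOn_insert_two_pi`, `latticeRotWardOn_of_uvCompactAt_of_latticeKingWardOn_single` — one irrational-over-`2π` angle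
  suffices;
* `latticeKingWardOn_of_latticeKingWard` — KING on all schemes ⇒ KING on any class (monotonicity);
* **`rot2'_of_kingOnClass`** — the candidate v5′ stub `KingOnClass` implies `ROT` rev 2′ (spelled out; compactness by the PROVED
  `stub_uvExtract`); `kingOnClass_of_kingSingleIR` — the rev-2 candidate stub `KingSingleIR` implies `KingOnClass` (`S = univ`,
  `θ = arcsin (3/5)`), so v5 work transfers to v5′.

No definition, no named fact, no sorry; standard axioms.  NOT a proof of E1.
-/

set_option autoImplicit false

noncomputable section

open scoped SchwartzMap
open MeasureTheory Filter Topology Real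
open Literature.MathematicalPhysics.QuantumFieldTheory Literature.MathematicalPhysics.QuantumLattice
open Literature.MathematicalPhysics.AQFT Literature.Probability.LatticeModels
open Summit.QuantumFields.YangMills.Cruxes.OSLegsFromFemtoAndGap.DlrCollarTransfer
open Summit.QuantumFields.YangMills.Cruxes.OSLegsAtWeakCouplingC.Sketch
open Summit.QuantumFields.YangMills.Cruxes.OSLegsAtWeakCouplingC.Y2Bridge
open Summit.QuantumFields.YangMills.Theorems.OSLegsFromFemtoAndGap (latticeDist)
open Summit.QuantumFields.YangMills.Theorems.OSLegsFromFemtoAndGap.Upgrade (isOffDiagonal_linActMulti)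
open Summit.QuantumFields.YangMills.Theorems.NPointIsotropy.Negative (E4)

namespace Summit.QuantumFields.YangMills.Theorems.ROT

section OnClass

variable {G : Type} [Group G] [TopologicalSpace G] [IsTopologicalGroup G] [CompactSpace G]
  [MeasurableSpace G] [BorelSpace G]

/-- **The King upgrade ON A TORUS CLASS**: UV sequential compactness off the diagonal at `(G, r, a)` plus vanishing finite-angle lattice
rotation defects on a set of angles `Θ` with dense additive closure, along the admissible schemes with tori in `S`, give the
infinitesimal lattice rotation-Ward identity along those schemes (`LatticeRotWardOn G r a S`).  Verbatim
`latticeRotWard_of_uvCompactAt_of_latticeKingWard` with the class threaded. [C. King, CMP 103 (1986) Thm 2.4 — mechanism] -/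
theorem latticeRotWardOn_of_uvCompactAt_of_latticeKingWardOn (r : LatticeRep G) (a : ℝ → ℝ) (hX : UVCompactAt r a)
    (Θ : Set ℝ) (hΘ : Dense ((AddSubgroup.closure Θ : AddSubgroup ℝ) : Set ℝ)) (S : Set ℕ)
    (hK : LatticeKingWardOn G r a Θ S) : LatticeRotWardOn G r a S := by
  -- adapted verbatim from `latticeRotWard_of_uvCompactAt_of_latticeKingWard` (Theorems/BalabanLadderROTOfKing.lean, seat g0)
  intro sch hS hunits hβ hranges
  obtain ⟨r₀, hr₀, hKs⟩ := hK sch hS hunits hβ hranges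
  refine ⟨r₀, hr₀, fun n hn F D hF hFc hδ hFr hD => ?_⟩
  obtain ⟨δ, hδ, hFδ⟩ := hδ
  have hDoff : IsOffDiagonal D :=
    GermWard.isOffDiagonal_of_tsupport_subset_separated hδ ((tsupport_rotDeriv_subset F D hD).trans hFδ)
  refine tendsto_of_subseq_tendsto fun ns hns => ?_
  obtain ⟨ψ, hψ, S₁, h1, hdens, hconv⟩ := hX sch ⟨hunits, hβ, hranges⟩ ns hns
  refine ⟨ψ, ?_⟩
  have hsub : Tendsto (ns ∘ ψ) atTop atTop := hns.comp hψ.tendsto_atTop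
  -- King invariance of the limit on the class, by uniqueness of limits along the subsequence
  have hKing : ∀ (m : ℕ), 2 ≤ m → ∀ F' ∈ King.KingClass m r₀, ∀ θ ∈ Θ,
      S₁ m (linActMulti (planeRot (0 : Fin 3) θ) F') = S₁ m F' := by
    intro m hm F' hF' θ hθ
    have hdiff := (hKs m hm F' hF' θ hθ).comp hsub
    have h₁ := hconv m hm (linActMulti (planeRot (0 : Fin 3) θ) F') (isOffDiagonal_linActMulti _ hF'.1)
    have h₂ := hconv m hm F' hF'.1
    exact sub_eq_zero.1 (tendsto_nhds_unique (h₁.sub h₂) hdiff)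
  -- germ invariance under every rotation of the (x₀,x₁)-plane (King's density argument, tree)
  have hgerm : ∀ φ : ℝ, GermInvariant S₁ (planeRot (0 : Fin 3) φ) r₀ :=
    King.germInvariant_planeRot_of_king S₁ hdens h1 hΘ hKing
  -- the orbit of `F` is constant and differentiable at `0` with derivative `S₁ n D`; hence `S₁ n D = 0`
  obtain ⟨B, hB⟩ := hdens n δ hδ
  have horbit : HasDerivAt (fun θ : ℝ => S₁ n (linActMulti (planeRot (0 : Fin 3) θ) F)) (S₁ n D) 0 :=
    GermWard.hasDerivAt_orbit_zero S₁ hB F D hFc hFδ hD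
  have hconst : (fun θ : ℝ => S₁ n (linActMulti (planeRot (0 : Fin 3) θ) F)) = fun _ => S₁ n F :=
    funext fun θ => hgerm θ n F hF hFr
  rw [hconst] at horbit
  have hD0 : S₁ n D = 0 := horbit.unique (hasDerivAt_const (0 : ℝ) (S₁ n F))
  -- convergence along the subsequence to `S₁ n D = 0`
  have hlim := hconv n hn D hDoff
  rw [hD0] at hlim
  simpa [Function.comp] using hlim

/-- **The finite-angle defect at `2π` vanishes identically on any class**: KING on `Θ` along the class gives KING on `insert (2π) Θ`
with the same germ radius. [folklore] -/
theorem latticeKingWardOn_insert_two_pi (r : LatticeRep G) (a : ℝ → ℝ) {Θ : Set ℝ} {S : Set ℕ}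
    (hK : LatticeKingWardOn G r a Θ S) : LatticeKingWardOn G r a (insert (2 * π) Θ) S := by
  intro sch hS hunits hβ hranges
  obtain ⟨r₀, hr₀, hKs⟩ := hK sch hS hunits hβ hranges
  refine ⟨r₀, hr₀, fun n hn F hF θ hθ => ?_⟩
  rcases Set.mem_insert_iff.1 hθ with rfl | hθ'
  · simp only [linActMulti_planeRot_two_pi, sub_self]
    exact tendsto_const_nhds
  · exact hKs n hn F hF θ hθ'

/-- **The King upgrade from ONE angle, on a class**: UV compactness plus KING at a single angle `θ₀` with `θ₀/(2π)` irrational along the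
schemes with tori in `S` give `LatticeRotWardOn G r a S`. [C. King, CMP 103 (1986) Thm 2.4 and (4.10) — mechanism] -/
theorem latticeRotWardOn_of_uvCompactAt_of_latticeKingWardOn_single (r : LatticeRep G) (a : ℝ → ℝ) (hX : UVCompactAt r a)
    {θ₀ : ℝ} (hθ : Irrational (θ₀ / (2 * π))) {S : Set ℕ} (hK : LatticeKingWardOn G r a {θ₀} S) :
    LatticeRotWardOn G r a S := by
  have hpair : LatticeKingWardOn G r a ({2 * π, θ₀} : Set ℝ) S := latticeKingWardOn_insert_two_pi r a hK
  refine latticeRotWardOn_of_uvCompactAt_of_latticeKingWardOn r a hX _ ?_ S hpair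
  rw [Set.pair_comm]
  exact dense_addSubgroupClosure_pair_iff.2 hθ

/-- **KING on all admissible schemes ⇒ KING on any class** (fewer schemes, weaker statement). [folklore] -/
theorem latticeKingWardOn_of_latticeKingWard (r : LatticeRep G) (a : ℝ → ℝ) {Θ : Set ℝ} (S : Set ℕ)
    (hK : LatticeKingWard G r a Θ) : LatticeKingWardOn G r a Θ S :=
  fun sch _ hunits hβ hranges => hK sch hunits hβ hranges

/-- **The rotation leg on all schemes ⇒ on any class.** [folklore] -/
theorem latticeRotWardOn_of_latticeRotWard (r : LatticeRep G) (a : ℝ → ℝ) (S : Set ℕ) (h : LatticeRotWard G r a) :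
    LatticeRotWardOn G r a S :=
  fun sch _ hunits hβ hranges => h sch hunits hβ hranges

end OnClass

/-! ## The closer of the candidate v5′ stub -/

/-- **`KingOnClass ⇒ ROT rev 2′`** (the rev-2′ text spelled out): for every compact simple `G`, `r`, positive unit map `a → 0` with
`LowerBounds`, `MomentBounds6`, `GapInUnits`, the stub supplies an unbounded class `S` and an irrational-over-`2π` angle with KING on `S`;
compactness from the PROVED `stub_uvExtract` and the one-angle upgrade on the class give `LatticeRotWardOn G r a S`.  The `LowerBounds`
guard is not used. [C. King, CMP 103 (1986) Thm 2.4 — mechanism] -/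
theorem rot2'_of_kingOnClass (h : KingOnClass) :
    ∀ (G : Type) [Group G] [TopologicalSpace G] [IsTopologicalGroup G] [CompactSpace G],
      IsCompactSimpleLieGroup G → letI : MeasurableSpace G := borel G; haveI : BorelSpace G := ⟨rfl⟩;
      ∀ (r : LatticeRep G) (a : ℝ → ℝ), (∀ β, 0 < a β) → Tendsto a atTop (𝓝 0) →
        LowerBounds G r a → MomentBounds6 G r a → GapInUnits G r a →
          ∃ S : Set ℕ, UnboundedClass S ∧ LatticeRotWardOn G r a S := by
  intro G _ _ _ _ hG
  letI : MeasurableSpace G := borel G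
  haveI : BorelSpace G := ⟨rfl⟩
  intro r a ha ha0 _ hUV hIR
  obtain ⟨S, hS, θ, hθ, hK⟩ := h G hG r a ha ha0 hUV hIR
  exact ⟨S, hS, latticeRotWardOn_of_uvCompactAt_of_latticeKingWardOn_single r a (stub_uvExtract G hG r a ha ha0 hUV) hθ hK⟩

/-- **The rev-2 candidate stub implies the rev-2′ candidate stub**: `KingSingleIR → KingOnClass` with `S = univ` and King's angle
`arcsin (3/5)` (irrational over `2π` by Niven).  So work under v5 transfers to v5′. [folklore] -/
theorem kingOnClass_of_kingSingleIR (h : KingSingleIR) : KingOnClass := by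
  intro G _ _ _ _ hG
  letI : MeasurableSpace G := borel G
  haveI : BorelSpace G := ⟨rfl⟩
  intro r a ha ha0 hUV hIR
  refine ⟨Set.univ, fun N => ⟨N, Set.mem_univ _, le_rfl⟩, Real.arcsin (3 / 5), irrational_arcsin_three_fifths_div_two_pi, ?_⟩
  exact latticeKingWardOn_of_latticeKingWard r a Set.univ (h G hG r a ha ha0 hUV hIR)

end Summit.QuantumFields.YangMills.Theorems.ROT

end
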